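import Mathlib.Analysis.Fourier.LpSpace
import Literature.Analysis.FunctionSpaces.PlancherelL1L2
import HarnessLib

/-!
# The `L²` Fourier transform and complex conjugation

Analysis/Fourier support file (theorem-only, no definitions, no named facts). For `u ∈ L²(V; ℂ)`
(`V` a finite-dimensional real inner product space) and `v ∈ L²(V; ℂ)` the class of the pointwise
conjugate `x ↦ conj u(x)`, Mathlib's `L²` Fourier transform `𝓕` and its inverse `𝓕⁻`
(`MeasureTheory.Lp.fourierTransformₗᵢ`, the extension by density of the Schwartz-space transform)
satisfy

* `fourier_conj_ae_eq`: `𝓕 v = conj ∘ 𝓕⁻ u` almost everywhere (Grafakos, Prop. 2.2.11 (5):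
  `(f̄)^ = conj((f̃)^)`, i.e. `𝓕(f̄)(ξ) = conj 𝓕f(−ξ) = conj 𝓕⁻f(ξ)`, stated there for Schwartz `f`
  and extended to `L²` by density as in §2.2.4);
* `fourierInv_conj_ae_eq`: `𝓕⁻ v = conj ∘ 𝓕 u` almost everywhere;
* the operator forms `fourier_conjLp`, `fourierInv_conjLp` for the conjugate-linear isometry
  `𝖩 := (starₗᵢ ℂ).compLpL 2 volume` of `L²(V; ℂ)` (`𝓕 ∘ 𝖩 = 𝖩 ∘ 𝓕⁻`, `𝓕⁻ ∘ 𝖩 = 𝖩 ∘ 𝓕`), with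
  `coeFn_conjLp` (`𝖩u = conj ∘ u` a.e.) and `conjLp_conjLp` (`𝖩𝖩 = id`).

Proof: both sides of the operator identity are continuous in `u` and agree on (the dense image of)
Schwartz functions, where the transforms are Fourier integrals (`SchwartzMap.toLp_fourier_eq`,
`SchwartzMap.toLp_fourierInv_eq`, the tree's `PlancherelL1L2.fourier_toLp_ae_eq_fourierIntegral` for
`conj ∘ φ ∈ L¹ ∩ L²`) and the identity is `conj ∫ 𝐞(⟨v,w⟩) f(v) dv = ∫ 𝐞(−⟨v,w⟩) conj f(v) dv`
(`fourierIntegral_conj`). Used in `NumberTheory/LFunctions/SuzukiWeilModelSpace.lean` (the Hardy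
space `H² = 𝓕⁻¹L²(0,∞)` has orthogonal complement `conj H²`).

## Mathlib search
`MeasureTheory.Lp.fourierTransformₗᵢ`, `SchwartzMap.toLp_fourier_eq`, `SchwartzMap.toLp_fourierInv_eq`,
`SchwartzMap.denseRange_toLpCLM`, `ContinuousLinearMap.compLpL`, `starₗᵢ`,
`Circle.starRingEnd_addChar`; the tree's `FluidPDE.FujitaKatoLocal.conj_fourier_schwartz` is the
function-level identity for Schwartz `φ` (not imported: unrelated dependency cone); no `L²`-level
statement exists.

## References
* L. Grafakos, *Classical Fourier Analysis*, 3rd ed., GTM 249, Springer 2014: Prop. 2.2.11 (5)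
  (PDF p. 126 of the held copy), §2.2.4 (PDF pp. 129–130). [Grafakos2014]
-/

noncomputable section

open MeasureTheory SchwartzMap Real FourierTransform Filter
open scoped ENNReal ComplexConjugate

namespace Literature.Analysis.Fourier

/-- `𝓕(conj ∘ f)(w) = conj (𝓕⁻ f)(w)` (function level; `conj 𝐞(t) = 𝐞(−t)`).
[cite: Grafakos2014, Prop. 2.2.11 (5), PDF p. 126] -/
theorem fourierIntegral_conj {W : Type*} [NormedAddCommGroup W] [InnerProductSpace ℝ W]
    [MeasurableSpace W] [BorelSpace W] [FiniteDimensional ℝ W] (f : W → ℂ) (w : W) :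
    𝓕 (fun x : W => conj (f x)) w = conj (𝓕⁻ f w) := by
  rw [Real.fourier_eq, Real.fourierInv_eq, ← integral_conj]
  refine integral_congr_ae (Eventually.of_forall fun v => ?_)
  simp only [Circle.smul_def, smul_eq_mul, map_mul, Circle.starRingEnd_addChar]

/-- `𝓕⁻(conj ∘ f)(w) = conj (𝓕 f)(w)` (function level). [cite: Grafakos2014, Prop. 2.2.11 (5), PDF p. 126] -/
theorem fourierIntegralInv_conj {W : Type*} [NormedAddCommGroup W] [InnerProductSpace ℝ W]
    [MeasurableSpace W] [BorelSpace W] [FiniteDimensional ℝ W] (f : W → ℂ) (w : W) :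
    𝓕⁻ (fun x : W => conj (f x)) w = conj (𝓕 f w) := by
  rw [Real.fourier_eq, Real.fourierInv_eq, ← integral_conj]
  refine integral_congr_ae (Eventually.of_forall fun v => ?_)
  simp only [Circle.smul_def, smul_eq_mul, map_mul, Circle.starRingEnd_addChar, neg_neg]

variable {V : Type*} [NormedAddCommGroup V] [InnerProductSpace ℝ V] [FiniteDimensional ℝ V]
  [MeasurableSpace V] [BorelSpace V]

/-- `𝖩u = conj ∘ u` almost everywhere, for the conjugation operator
`𝖩 = (starₗᵢ ℂ).compLpL 2 volume` of `L²(V; ℂ)` (the `L²` class of Grafakos' `f̄`).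
[cite: Grafakos2014, §2.2.2, Prop. 2.2.11 (5), PDF p. 126] -/
theorem coeFn_conjLp (u : Lp ℂ 2 (volume : Measure V)) :
    ((((starₗᵢ ℂ : ℂ ≃ₗᵢ⋆[ℂ] ℂ).toContinuousLinearEquiv : ℂ →L⋆[ℂ] ℂ).compLpL 2
        (volume : Measure V) u : Lp ℂ 2 (volume : Measure V)) : V → ℂ) =ᵐ[volume]
      fun x => conj ((u : V → ℂ) x) :=
  ContinuousLinearMap.coeFn_compLpL _ u

/-- The conjugate `f̄ = conj ∘ φ` of a Schwartz function `φ` is in every `Lᵖ` (`‖conj z‖ = ‖z‖`).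
[cite: Grafakos2014, §2.2.2, Prop. 2.2.11 (5), PDF p. 126] -/
theorem memLp_conj_schwartz {W : Type*} [NormedAddCommGroup W] [NormedSpace ℝ W]
    [MeasurableSpace W] [OpensMeasurableSpace W] {μ : Measure W} [μ.HasTemperateGrowth]
    (φ : 𝓢(W, ℂ)) (p : ℝ≥0∞) : MemLp (fun x : W => conj (φ x)) p μ :=
  MemLp.of_le (φ.memLp p μ) (Complex.continuous_conj.comp φ.continuous).aestronglyMeasurable
    (Eventually.of_forall fun _ => (Complex.norm_conj _).le)

/-- `𝖩[φ] = [conj ∘ φ]` for a Schwartz function `φ` (the `L²` class of `f̄`).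
[cite: Grafakos2014, §2.2.2, Prop. 2.2.11 (5), PDF p. 126] -/
theorem conjLp_toLp_schwartz (φ : 𝓢(V, ℂ)) :
    ((starₗᵢ ℂ : ℂ ≃ₗᵢ⋆[ℂ] ℂ).toContinuousLinearEquiv : ℂ →L⋆[ℂ] ℂ).compLpL 2 (volume : Measure V)
        (φ.toLp 2 (volume : Measure V)) =
      (memLp_conj_schwartz φ 2).toLp (fun x : V => conj (φ x)) := by
  apply Lp.ext
  filter_upwards [coeFn_conjLp (φ.toLp 2 (volume : Measure V)), φ.coeFn_toLp 2 (volume : Measure V),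
    (memLp_conj_schwartz (μ := (volume : Measure V)) φ 2).coeFn_toLp] with x h1 h2 h3
  rw [h1, h2, h3]

/-- **`𝓕 ∘ 𝖩 = 𝖩 ∘ 𝓕⁻` on `L²(V; ℂ)`**: the Fourier transform of the conjugate class is the
conjugate of the inverse transform (on Schwartz functions both sides are `conj ∘ 𝓕⁻φ`; both sides
are continuous and Schwartz functions are dense). [cite: Grafakos2014, Prop. 2.2.11 (5), PDF p. 126; §2.2.4, PDF pp. 129–130] -/
theorem fourier_conjLp (u : Lp ℂ 2 (volume : Measure V)) :
    (𝓕 (((starₗᵢ ℂ : ℂ ≃ₗᵢ⋆[ℂ] ℂ).toContinuousLinearEquiv : ℂ →L⋆[ℂ] ℂ).compLpL 2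
        (volume : Measure V) u) : Lp ℂ 2 (volume : Measure V)) =
      ((starₗᵢ ℂ : ℂ ≃ₗᵢ⋆[ℂ] ℂ).toContinuousLinearEquiv : ℂ →L⋆[ℂ] ℂ).compLpL 2
        (volume : Measure V) (𝓕⁻ u : Lp ℂ 2 (volume : Measure V)) := by
  set J := ((starₗᵢ ℂ : ℂ ≃ₗᵢ⋆[ℂ] ℂ).toContinuousLinearEquiv : ℂ →L⋆[ℂ] ℂ).compLpL 2
    (volume : Measure V) with hJ
  have hJc : Continuous (J : Lp ℂ 2 (volume : Measure V) → Lp ℂ 2 (volume : Measure V)) :=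
    J.continuous
  have hd := SchwartzMap.denseRange_toLpCLM (E := V) (F := ℂ) (p := 2) (μ := (volume : Measure V))
    ENNReal.ofNat_ne_top
  refine congrFun (hd.equalizer
    ((continuous_fourier (E := Lp ℂ 2 (volume : Measure V))).comp hJc)
    (hJc.comp (continuous_fourierInv (E := Lp ℂ 2 (volume : Measure V)))) ?_) u
  funext φ
  simp only [Function.comp_apply, SchwartzMap.toLpCLM_apply]
  have hint : Integrable (fun x : V => conj (φ x)) (volume : Measure V) :=
    memLp_one_iff_integrable.1 (memLp_conj_schwartz φ 1)
  rw [hJ, conjLp_toLp_schwartz, SchwartzMap.toLp_fourierInv_eq]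
  apply Lp.ext
  filter_upwards [Literature.Analysis.FunctionSpaces.fourier_toLp_ae_eq_fourierIntegral hint
      (memLp_conj_schwartz φ 2),
    coeFn_conjLp ((𝓕⁻ φ).toLp 2 (volume : Measure V)),
    (𝓕⁻ φ).coeFn_toLp 2 (volume : Measure V)] with w h1 h2 h3
  rw [h1, h2, h3, SchwartzMap.fourierInv_coe]
  exact fourierIntegral_conj φ w

/-- `𝖩𝖩 = id` on `L²(V; ℂ)` (`conj conj z = z`). [cite: Grafakos2014, §2.2.2, Prop. 2.2.11 (5), PDF p. 126] -/
theorem conjLp_conjLp (u : Lp ℂ 2 (volume : Measure V)) :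
    ((starₗᵢ ℂ : ℂ ≃ₗᵢ⋆[ℂ] ℂ).toContinuousLinearEquiv : ℂ →L⋆[ℂ] ℂ).compLpL 2 (volume : Measure V)
      (((starₗᵢ ℂ : ℂ ≃ₗᵢ⋆[ℂ] ℂ).toContinuousLinearEquiv : ℂ →L⋆[ℂ] ℂ).compLpL 2
        (volume : Measure V) u) = u := by
  apply Lp.ext
  filter_upwards [coeFn_conjLp (((starₗᵢ ℂ : ℂ ≃ₗᵢ⋆[ℂ] ℂ).toContinuousLinearEquiv :
      ℂ →L⋆[ℂ] ℂ).compLpL 2 (volume : Measure V) u), coeFn_conjLp u] with x h1 h2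
  rw [h1, h2, Complex.conj_conj]

/-- **`𝓕⁻ ∘ 𝖩 = 𝖩 ∘ 𝓕` on `L²(V; ℂ)`** (apply `fourier_conjLp` to `𝖩u` and invert).
[cite: Grafakos2014, Prop. 2.2.11 (5), PDF p. 126; §2.2.4, PDF pp. 129–130] -/
theorem fourierInv_conjLp (u : Lp ℂ 2 (volume : Measure V)) :
    (𝓕⁻ (((starₗᵢ ℂ : ℂ ≃ₗᵢ⋆[ℂ] ℂ).toContinuousLinearEquiv : ℂ →L⋆[ℂ] ℂ).compLpL 2
        (volume : Measure V) u) : Lp ℂ 2 (volume : Measure V)) =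
      ((starₗᵢ ℂ : ℂ ≃ₗᵢ⋆[ℂ] ℂ).toContinuousLinearEquiv : ℂ →L⋆[ℂ] ℂ).compLpL 2
        (volume : Measure V) (𝓕 u : Lp ℂ 2 (volume : Measure V)) := by
  have h := fourier_conjLp (𝓕 u : Lp ℂ 2 (volume : Measure V))
  rw [fourierInv_fourier_eq] at h
  rw [← h, fourierInv_fourier_eq]

/-- **`𝓕 v = conj ∘ 𝓕⁻ u` a.e. whenever `v = conj ∘ u` a.e.** (operator-free form of
`fourier_conjLp`). [cite: Grafakos2014, Prop. 2.2.11 (5), PDF p. 126; §2.2.4, PDF pp. 129–130] -/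
theorem fourier_conj_ae_eq {u v : Lp ℂ 2 (volume : Measure V)}
    (h : (v : V → ℂ) =ᵐ[volume] fun x => conj ((u : V → ℂ) x)) :
    ((𝓕 v : Lp ℂ 2 (volume : Measure V)) : V → ℂ) =ᵐ[volume]
      fun x => conj (((𝓕⁻ u : Lp ℂ 2 (volume : Measure V)) : V → ℂ) x) := by
  have hv : v = ((starₗᵢ ℂ : ℂ ≃ₗᵢ⋆[ℂ] ℂ).toContinuousLinearEquiv : ℂ →L⋆[ℂ] ℂ).compLpL 2
      (volume : Measure V) u := Lp.ext (h.trans (coeFn_conjLp u).symm)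
  rw [hv, fourier_conjLp]
  exact coeFn_conjLp _

/-- **`𝓕⁻ v = conj ∘ 𝓕 u` a.e. whenever `v = conj ∘ u` a.e.** (operator-free form of
`fourierInv_conjLp`). [cite: Grafakos2014, Prop. 2.2.11 (5), PDF p. 126; §2.2.4, PDF pp. 129–130] -/
theorem fourierInv_conj_ae_eq {u v : Lp ℂ 2 (volume : Measure V)}
    (h : (v : V → ℂ) =ᵐ[volume] fun x => conj ((u : V → ℂ) x)) :
    ((𝓕⁻ v : Lp ℂ 2 (volume : Measure V)) : V → ℂ) =ᵐ[volume]
      fun x => conj (((𝓕 u : Lp ℂ 2 (volume : Measure V)) : V → ℂ) x) := by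
  have hv : v = ((starₗᵢ ℂ : ℂ ≃ₗᵢ⋆[ℂ] ℂ).toContinuousLinearEquiv : ℂ →L⋆[ℂ] ℂ).compLpL 2
      (volume : Measure V) u := Lp.ext (h.trans (coeFn_conjLp u).symm)
  rw [hv, fourierInv_conjLp]
  exact coeFn_conjLp _

end Literature.Analysis.Fourier

end
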